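import Literature.Probability.Percolation.KozmaNitzanClusterPropertyReal
import HarnessLib

/-!
# `NoHeavyLowerTail` (stmt-CriticalPhenomena-4575) — EXPLICIT universal gluing coefficients at `|A| = 2`:
# Kozma–Nitzan's Theorem-1 coefficients `(α, β)` serve every monotone cluster property

Support file (`--supports stmt-CriticalPhenomena-4575`), prover `prim-ineq-gen-7` (gen 7).  No definitions, no named facts, no sorries; standard axioms.
Companion of `…KNUniversalGluingCoefficients.lean` (this seat, p205861): there, for every `A`, ONE probability vector `c` on `A` with
`Σ_a c_a E[F(C_a); 0 ↔ A] ≤ E[F(C_0); 0 ↔ A]` for every monotone `F` is obtained NON-constructively (LP duality).  Here, for `A = {a₁, a₂}`,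
the coefficients are EXPLICIT and are Kozma–Nitzan's (5) (arXiv:2401.12397, Thm 1, pp. 7–8): with `D = {a₁ ↮ a₂}`, `u_i = μ(D ∩ {0 ↔ a_i})`,
    `u₁ · E[F(C_{a₁}); 0 ↔ A] + u₂ · E[F(C_{a₂}); 0 ↔ A] ≤ (u₁ + u₂) · E[F(C_0); 0 ↔ A]`      (`UniversalGluing.pair_coeff_clusterFun`)
for EVERY real `F` monotone on vertex sets — Theorem 7 (Conjecture 4 at `|A| = 2`, p. 32, proof omitted in print) in the coefficient form of
Theorem 1's display (6); the tree had the coefficient form only for `F = 1{b ∈ ·}` (`KNPreFKG.preFKG_pair_coeff`) and the min form for real `F`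
(`KNPreFKG.clusterFun_pair`).  Proof = the printed "BHK four times" given `D` (vdBHK Thm 1.3 inside `C_{a_i}`, Thm 1.5 across `C_{a₁}`/`C_{a₂}`, integral
forms `BHK2006_clusterConditionalPositiveAssociation_holds`, `BHK2006_twoClusterConditionalAssociation.negCorrelation`), after which the two lower
bounds cancel EXACTLY against the coefficients (no case split on which relay has the smaller mean).  Normalised form: `UniversalGluing.pair_coeff_normalised`.
(The normalised `(α, β)` is also the solution of Kozma–Nitzan's §5.2 linear system `Σ_a c_a P(0↔A, a↔a') = P(0↔a')` at `|A| = 2`.)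
[cite: KozmaNitzan2024, Thm. 1 with (5)–(6) (pp. 7–8), Thm. 7 and Conj. 4 (p. 32), Question 5 (p. 32)] [cite: VandenbergHaggstromKahn2005, Thms. 1.3, 1.5]
-/

noncomputable section

namespace Summit.CriticalPhenomena.PercolationContinuityZ3.Theorems

open MeasureTheory Set Literature.Probability.LatticeModels Literature.Probability.Percolation
open Literature.Probability.Percolation.KNPreFKG
open scoped Classical

namespace UniversalGluing

variable {V : Type*} [Fintype V]

/-- **Theorem 7 with Theorem 1's coefficients (division-free form).**  For `F` monotone on vertex sets, vertices `0, a₁, a₂`, `U = {0↔a₁} ∪ {0↔a₂}`,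
`D = {a₁ ↮ a₂}`:  `μ(D ∩ {0↔a₁})·∫_U F(C_{a₁}) + μ(D ∩ {0↔a₂})·∫_U F(C_{a₂}) ≤ (μ(D ∩ {0↔a₁}) + μ(D ∩ {0↔a₂}))·∫_U F(C_0)`.
[cite: KozmaNitzan2024, Thm. 1 (5)–(6) (pp. 7–8), Thm. 7 (p. 32)] [cite: VandenbergHaggstromKahn2005, Thms. 1.3, 1.5] -/
theorem pair_coeff_clusterFun (w : Sym2 V → unitInterval) (o a₁ a₂ : V) (F : Set V → ℝ)
    (hF : ∀ S T : Set V, S ⊆ T → F S ≤ F T) :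
    (prodBernoulli w).real ({ω | ¬ (openGraph ω).Reachable a₁ a₂} ∩ openConn o a₁) *
        ∫ ω in (openConn o a₁ ∪ openConn o a₂), F (openCluster ω a₁) ∂(prodBernoulli w) +
      (prodBernoulli w).real ({ω | ¬ (openGraph ω).Reachable a₁ a₂} ∩ openConn o a₂) *
        ∫ ω in (openConn o a₁ ∪ openConn o a₂), F (openCluster ω a₂) ∂(prodBernoulli w) ≤
    ((prodBernoulli w).real ({ω | ¬ (openGraph ω).Reachable a₁ a₂} ∩ openConn o a₁) +
        (prodBernoulli w).real ({ω | ¬ (openGraph ω).Reachable a₁ a₂} ∩ openConn o a₂)) *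
      ∫ ω in (openConn o a₁ ∪ openConn o a₂), F (openCluster ω o) ∂(prodBernoulli w) := by
  classical
  set μ := prodBernoulli w with hμ
  set f₀ : BondConfig V → ℝ := fun ω => F (openCluster ω o) with hf₀
  set f₁ : BondConfig V → ℝ := fun ω => F (openCluster ω a₁) with hf₁
  set f₂ : BondConfig V → ℝ := fun ω => F (openCluster ω a₂) with hf₂
  have hmeas : ∀ T : Set (BondConfig V), MeasurableSet T := fun _ => MeasurableSet.of_discrete
  have hint : ∀ (k : BondConfig V → ℝ) (T : Set (BondConfig V)), IntegrableOn k T μ :=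
    fun k T => (Integrable.of_finite).integrableOn
  set D : Set (BondConfig V) := {ω | ¬ (openGraph ω).Reachable a₁ a₂} with hD
  by_cases h12 : a₁ = a₂
  · -- `A` is a singleton: `D = ∅`, every coefficient vanishes
    subst h12
    have hD0 : D = ∅ := by
      ext ω
      simp only [hD, mem_setOf_eq, mem_empty_iff_false, iff_false, not_not]
      exact SimpleGraph.Reachable.refl _
    simp [hD0]
  set O₁ : Set (BondConfig V) := openConn o a₁ with hO₁
  set O₂ : Set (BondConfig V) := openConn o a₂ with hO₂
  set U : Set (BondConfig V) := O₁ ∪ O₂ with hU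
  -- set identities
  have hU1 : U \ O₁ = D ∩ O₂ := by
    ext ω
    simp only [hU, hO₁, hO₂, hD, mem_sdiff, mem_union, mem_inter_iff, openConn, mem_setOf_eq]
    constructor
    · rintro ⟨h1 | h2, hn1⟩
      · exact absurd h1 hn1
      · exact ⟨fun h => hn1 (h2.trans h.symm), h2⟩
    · rintro ⟨hn, h2⟩
      exact ⟨Or.inr h2, fun h1 => hn (h1.symm.trans h2)⟩
  have hU2 : U \ O₂ = D ∩ O₁ := by
    ext ω
    simp only [hU, hO₁, hO₂, hD, mem_sdiff, mem_union, mem_inter_iff, openConn, mem_setOf_eq]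
    constructor
    · rintro ⟨h1 | h2, hn2⟩
      · exact ⟨fun h => hn2 (h1.trans h), h1⟩
      · exact absurd h2 hn2
    · rintro ⟨hn, h1⟩
      exact ⟨Or.inl h1, fun h2 => hn (h1.symm.trans h2)⟩
  have hO1U : U ∩ O₁ = O₁ := inter_eq_right.2 subset_union_left
  have hO2U : U ∩ O₂ = O₂ := inter_eq_right.2 subset_union_right
  -- same cluster ⇒ same value
  have h01 : ∀ ω ∈ O₁, f₀ ω = f₁ ω := fun ω hω => by
    simp only [hf₀, hf₁]; rw [openCluster_eq_of_reachable (hω : (openGraph ω).Reachable o a₁)]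
  have h02 : ∀ ω ∈ O₂, f₀ ω = f₂ ω := fun ω hω => by
    simp only [hf₀, hf₂]; rw [openCluster_eq_of_reachable (hω : (openGraph ω).Reachable o a₂)]
  -- the two "subtract the common event" identities
  have hsplit : ∀ (k : BondConfig V → ℝ) (T : Set (BondConfig V)),
      ∫ ω in U, k ω ∂μ = ∫ ω in U ∩ T, k ω ∂μ + ∫ ω in U \ T, k ω ∂μ :=
    fun k T => (integral_inter_add_sdiff (hmeas T) (hint k U)).symm
  have hdiff1 : ∫ ω in U, f₀ ω ∂μ - ∫ ω in U, f₁ ω ∂μ =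
      ∫ ω in D ∩ O₂, f₂ ω ∂μ - ∫ ω in D ∩ O₂, f₁ ω ∂μ := by
    rw [hsplit f₀ O₁, hsplit f₁ O₁, hO1U, hU1, setIntegral_congr_fun (hmeas O₁) h01,
      setIntegral_congr_fun ((hmeas D).inter (hmeas O₂)) fun ω hω => h02 ω hω.2]
    ring
  have hdiff2 : ∫ ω in U, f₀ ω ∂μ - ∫ ω in U, f₂ ω ∂μ =
      ∫ ω in D ∩ O₁, f₁ ω ∂μ - ∫ ω in D ∩ O₁, f₂ ω ∂μ := by
    rw [hsplit f₀ O₂, hsplit f₂ O₂, hO2U, hU2, setIntegral_congr_fun (hmeas O₂) h02,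
      setIntegral_congr_fun ((hmeas D).inter (hmeas O₁)) fun ω hω => h01 ω hω.2]
    ring
  -- "Applying BHK 4 times", given `D = {a₁ ↮ a₂}`
  have hD1 : {ω : BondConfig V | ∀ x ∈ ({a₂} : Set V), ¬ (openGraph ω).Reachable a₁ x} = D := by
    ext ω
    simp [hD]
  have hD2 : {ω : BondConfig V | ∀ x ∈ ({a₁} : Set V), ¬ (openGraph ω).Reachable a₂ x} = D := by
    ext ω
    simp only [mem_setOf_eq, mem_singleton_iff, forall_eq, hD]
    exact not_congr ⟨SimpleGraph.Reachable.symm, SimpleGraph.Reachable.symm⟩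
  have hD3 : {ω : BondConfig V | ¬ (openGraph ω).Reachable a₂ a₁} = D := by
    ext ω
    simp only [mem_setOf_eq, hD]
    exact not_congr ⟨SimpleGraph.Reachable.symm, SimpleGraph.Reachable.symm⟩
  have hind1 : ∀ ω : BondConfig V, (connFamily a₁ o).indicator (1 : Set (Sym2 V) → ℝ) (openEdgeCluster ω a₁) =
      O₁.indicator (1 : BondConfig V → ℝ) ω := fun ω => by
    rw [congrFun (indicator_comp_openEdgeCluster (connFamily a₁ o) a₁) ω, ← openConn_eq_setOf_connFamily,
      openConn_symm a₁ o]
  have hind2 : ∀ ω : BondConfig V, (connFamily a₂ o).indicator (1 : Set (Sym2 V) → ℝ) (openEdgeCluster ω a₂) =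
      O₂.indicator (1 : BondConfig V → ℝ) ω := fun ω => by
    rw [congrFun (indicator_comp_openEdgeCluster (connFamily a₂ o) a₂) ω, ← openConn_eq_setOf_connFamily,
      openConn_symm a₂ o]
  have hprod : ∀ (T : Set (BondConfig V)) (k : BondConfig V → ℝ),
      ∫ ω in D, T.indicator (1 : BondConfig V → ℝ) ω * k ω ∂μ = ∫ ω in D ∩ T, k ω ∂μ := by
    intro T k
    rw [← setIntegral_mul_indicator_one μ D T k]
    refine setIntegral_congr_fun (hmeas D) fun ω _ => ?_
    ring
  -- (i) Thm 1.3 in `C_{a₂}`: `μ(D ∩ O₂) ∫_D f₂ ≤ μ(D) ∫_{D ∩ O₂} f₂`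
  have h_i := BHK2006_clusterConditionalPositiveAssociation_holds V w a₂ ({a₁} : Set V)
    ((connFamily a₂ o).indicator 1) (fun C => F {a | a = a₂ ∨ ∃ e ∈ C, a ∈ e})
    (monotone_indicator_one_of_isUpperSet (isUpperSet_connFamily a₂ o)) (monotone_clusterFun a₂ F hF)
    (by simpa using Ne.symm h12)
  simp only [hD2, clusterFun_openEdgeCluster, hind2] at h_i
  rw [setIntegral_indicator_one_eq, hprod O₂] at h_i
  -- (ii) Thm 1.5 across `C_{a₂}`, `C_{a₁}`: `μ(D) ∫_{D ∩ O₂} f₁ ≤ μ(D ∩ O₂) ∫_D f₁`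
  have h_ii := BHK2006_twoClusterConditionalAssociation.negCorrelation
    BHK2006_twoClusterConditionalAssociation_holds V w a₂ a₁
    ((connFamily a₂ o).indicator 1) (fun C => F {a | a = a₁ ∨ ∃ e ∈ C, a ∈ e})
    (monotone_indicator_one_of_isUpperSet (isUpperSet_connFamily a₂ o)) (monotone_clusterFun a₁ F hF)
    (Ne.symm h12)
  simp only [hD3, clusterFun_openEdgeCluster, hind2] at h_ii
  rw [setIntegral_indicator_one_eq, hprod O₂] at h_ii
  -- (iii) Thm 1.3 in `C_{a₁}`: `μ(D ∩ O₁) ∫_D f₁ ≤ μ(D) ∫_{D ∩ O₁} f₁`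
  have h_iii := BHK2006_clusterConditionalPositiveAssociation_holds V w a₁ ({a₂} : Set V)
    ((connFamily a₁ o).indicator 1) (fun C => F {a | a = a₁ ∨ ∃ e ∈ C, a ∈ e})
    (monotone_indicator_one_of_isUpperSet (isUpperSet_connFamily a₁ o)) (monotone_clusterFun a₁ F hF)
    (by simpa using h12)
  simp only [hD1, clusterFun_openEdgeCluster, hind1] at h_iii
  rw [setIntegral_indicator_one_eq, hprod O₁] at h_iii
  -- (iv) Thm 1.5 across `C_{a₁}`, `C_{a₂}`: `μ(D) ∫_{D ∩ O₁} f₂ ≤ μ(D ∩ O₁) ∫_D f₂`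
  have h_iv := BHK2006_twoClusterConditionalAssociation.negCorrelation
    BHK2006_twoClusterConditionalAssociation_holds V w a₁ a₂
    ((connFamily a₁ o).indicator 1) (fun C => F {a | a = a₂ ∨ ∃ e ∈ C, a ∈ e})
    (monotone_indicator_one_of_isUpperSet (isUpperSet_connFamily a₁ o)) (monotone_clusterFun a₂ F hF)
    h12
  simp only [clusterFun_openEdgeCluster, hind1] at h_iv
  rw [setIntegral_indicator_one_eq, hprod O₁] at h_iv
  change μ.real (D ∩ O₂) * ∫ ω in D, f₂ ω ∂μ ≤ μ.real D * ∫ ω in D ∩ O₂, f₂ ω ∂μ at h_i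
  change μ.real D * ∫ ω in D ∩ O₂, f₁ ω ∂μ ≤ μ.real (D ∩ O₂) * ∫ ω in D, f₁ ω ∂μ at h_ii
  change μ.real (D ∩ O₁) * ∫ ω in D, f₁ ω ∂μ ≤ μ.real D * ∫ ω in D ∩ O₁, f₁ ω ∂μ at h_iii
  change μ.real D * ∫ ω in D ∩ O₁, f₂ ω ∂μ ≤ μ.real (D ∩ O₁) * ∫ ω in D, f₂ ω ∂μ at h_iv
  -- the two printed lower bounds, each multiplied by `μ(D)`:
  have key1 : μ.real D * (∫ ω in U, f₀ ω ∂μ - ∫ ω in U, f₁ ω ∂μ) ≥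
      μ.real (D ∩ O₂) * (∫ ω in D, f₂ ω ∂μ - ∫ ω in D, f₁ ω ∂μ) := by
    rw [hdiff1, mul_sub, mul_sub]
    linarith [h_i, h_ii]
  have key2 : μ.real D * (∫ ω in U, f₀ ω ∂μ - ∫ ω in U, f₂ ω ∂μ) ≥
      μ.real (D ∩ O₁) * (∫ ω in D, f₁ ω ∂μ - ∫ ω in D, f₂ ω ∂μ) := by
    rw [hdiff2, mul_sub, mul_sub]
    linarith [h_iii, h_iv]
  -- "collecting terms": with the un-normalised coefficients the two lower bounds cancel EXACTLY
  have hsum : μ.real D * (μ.real (D ∩ O₁) * (∫ ω in U, f₀ ω ∂μ - ∫ ω in U, f₁ ω ∂μ) +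
      μ.real (D ∩ O₂) * (∫ ω in U, f₀ ω ∂μ - ∫ ω in U, f₂ ω ∂μ)) ≥ 0 := by
    have hO1n : 0 ≤ μ.real (D ∩ O₁) := measureReal_nonneg
    have hO2n : 0 ≤ μ.real (D ∩ O₂) := measureReal_nonneg
    have := add_le_add (mul_le_mul_of_nonneg_left key1 hO1n) (mul_le_mul_of_nonneg_left key2 hO2n)
    nlinarith [this]
  show μ.real (D ∩ O₁) * ∫ ω in U, f₁ ω ∂μ + μ.real (D ∩ O₂) * ∫ ω in U, f₂ ω ∂μ ≤
    (μ.real (D ∩ O₁) + μ.real (D ∩ O₂)) * ∫ ω in U, f₀ ω ∂μ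
  by_cases hD0 : μ.real D = 0
  · -- degenerate case: `μ(D) = 0` forces both coefficients to vanish
    have hz : ∀ T : Set (BondConfig V), μ.real (D ∩ T) = 0 := fun T =>
      le_antisymm ((measureReal_mono inter_subset_left).trans hD0.le) measureReal_nonneg
    rw [hz, hz]
    simp
  · have hDpos : 0 < μ.real D := lt_of_le_of_ne measureReal_nonneg (Ne.symm hD0)
    have : μ.real (D ∩ O₁) * (∫ ω in U, f₀ ω ∂μ - ∫ ω in U, f₁ ω ∂μ) +
        μ.real (D ∩ O₂) * (∫ ω in U, f₀ ω ∂μ - ∫ ω in U, f₂ ω ∂μ) ≥ 0 :=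
      nonneg_of_mul_nonneg_right (by simpa [mul_comm] using hsum) hDpos
    nlinarith [this]

/-- **Explicit universal coefficients at `|A| = 2` (normalised form).**  With `u_i = μ({a₁ ↮ a₂} ∩ {0 ↔ a_i})` and `u₁ + u₂ > 0`, the probability
vector `(α, β) = (u₁, u₂)/(u₁ + u₂)` — Kozma–Nitzan's (5) — satisfies `α·E[F(C_{a₁}); 0↔A] + β·E[F(C_{a₂}); 0↔A] ≤ E[F(C_0); 0↔A]` for EVERY
monotone `F`, `A = {a₁, a₂}`.  (When `u₁ + u₂ = 0`, i.e. `μ(a₁ ↮ a₂, 0 ↔ A) = 0`, the three restricted means coincide and any probability vector works.)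
[cite: KozmaNitzan2024, Thm. 1 (5)–(6) (pp. 7–8), Thm. 7 (p. 32)] -/
theorem pair_coeff_normalised (w : Sym2 V → unitInterval) (o a₁ a₂ : V) (F : Set V → ℝ)
    (hF : ∀ S T : Set V, S ⊆ T → F S ≤ F T)
    (hpos : 0 < (prodBernoulli w).real ({ω | ¬ (openGraph ω).Reachable a₁ a₂} ∩ openConn o a₁) +
      (prodBernoulli w).real ({ω | ¬ (openGraph ω).Reachable a₁ a₂} ∩ openConn o a₂)) :
    (prodBernoulli w).real ({ω | ¬ (openGraph ω).Reachable a₁ a₂} ∩ openConn o a₁) /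
          ((prodBernoulli w).real ({ω | ¬ (openGraph ω).Reachable a₁ a₂} ∩ openConn o a₁) +
            (prodBernoulli w).real ({ω | ¬ (openGraph ω).Reachable a₁ a₂} ∩ openConn o a₂)) *
        ∫ ω in (openConn o a₁ ∪ openConn o a₂), F (openCluster ω a₁) ∂(prodBernoulli w) +
      (prodBernoulli w).real ({ω | ¬ (openGraph ω).Reachable a₁ a₂} ∩ openConn o a₂) /
          ((prodBernoulli w).real ({ω | ¬ (openGraph ω).Reachable a₁ a₂} ∩ openConn o a₁) +
            (prodBernoulli w).real ({ω | ¬ (openGraph ω).Reachable a₁ a₂} ∩ openConn o a₂)) *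
        ∫ ω in (openConn o a₁ ∪ openConn o a₂), F (openCluster ω a₂) ∂(prodBernoulli w) ≤
      ∫ ω in (openConn o a₁ ∪ openConn o a₂), F (openCluster ω o) ∂(prodBernoulli w) := by
  have h := pair_coeff_clusterFun w o a₁ a₂ F hF
  set u₁ := (prodBernoulli w).real ({ω | ¬ (openGraph ω).Reachable a₁ a₂} ∩ openConn o a₁) with hu₁
  set u₂ := (prodBernoulli w).real ({ω | ¬ (openGraph ω).Reachable a₁ a₂} ∩ openConn o a₂) with hu₂
  set I₁ := ∫ ω in (openConn o a₁ ∪ openConn o a₂), F (openCluster ω a₁) ∂(prodBernoulli w) with hI₁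
  set I₂ := ∫ ω in (openConn o a₁ ∪ openConn o a₂), F (openCluster ω a₂) ∂(prodBernoulli w) with hI₂
  set I₀ := ∫ ω in (openConn o a₁ ∪ openConn o a₂), F (openCluster ω o) ∂(prodBernoulli w) with hI₀
  rw [div_mul_eq_mul_div, div_mul_eq_mul_div, ← add_div, div_le_iff₀ hpos]
  linarith [h]

end UniversalGluing

end Summit.CriticalPhenomena.PercolationContinuityZ3.Theorems

end
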